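import Mathlib
import HarnessLib
import Literature.ComputerArithmetic.DeDinechinLauterMullerTorres2013.ZivRoundingTest

/-!
# Lauter–Lefèvre: the rounding-boundary (exact and midpoint) cases of `pow` in binary64

C. Q. Lauter, V. Lefèvre, *An efficient rounding boundary test for `pow(x, y)` in double precision*,
IEEE Trans. Computers 58(2):197–207 (2009) [LauterLefevre2009]; read in the authors' research-report
version, LIP RR2007-36 = HAL ensl-00169409v2 [LauterLefevre2007RR] (same section numbering; quoted below).

## What is printed

* §2.1: `𝔽_k = {2^E·m | E ∈ ℤ, m ∈ ℤ, 2^(k−1) ≤ |m| ≤ 2^k − 1} ∪ {0}` (precision-`k` floats, UNBOUNDED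
  exponent range); `𝔻 ⊆ 𝔽₅₃` = binary64. "The midpoints of numbers in `𝔽_k` are numbers in `𝔽_(k+1)` with
  odd significand. Since `𝔽_k ⊂ 𝔽_(k+1)`, the rounding boundaries of all considered rounding-modes lie in
  `𝔽_(k+1)`. Testing whether `pow(x, y)` is a rounding boundary case in double precision hence means
  computing the predicate `RB(x, y) = (x^y ∈ 𝔽₅₄)`."
* §2.3: "`x = 2^E·m`, `y = 2^F·n`, `z = 2^G·k` where `E, F, G ∈ ℤ`, `m, k ∈ 2ℕ+1` and `n ∈ 2ℤ+1`. Testing a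
  rounding boundary case … means thus checking if `2^(2^F·E·n)·m^(2^F·n) = 2^G·k`."
* §4, **Lemma 4.1**: "Assume that `E, F, G ∈ ℤ`, `m, n, k ∈ 2ℕ+1`. Thus
  `2^(E·2^F·n)·m^(2^F·n) = 2^G·k ⟺ E·2^F·n = G ∧ m^(2^F·n) = k`."
  **Lemma 4.2**: "Let `m ∈ 2ℕ+1`, `3 ≤ m ≤ 2^53 − 1`. Let `n ∈ 2ℕ+1`, `1 ≤ n ≤ 2^53 − 1`. Let `k ∈ 2ℕ+1`,
  `1 ≤ k ≤ 2^54 − 1`. Let `F ∈ ℤ`. Assume that `m^(2^F·n) = k`. Thus, `2^F·n ≤ 35` and `−5 ≤ F ≤ 5`."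
  **Lemma 4.3**: "Assume `m, n, k ∈ 2ℕ+1`, `F ∈ ℤ`, `F ≤ −1`. Thus
  `m^(2^F·n) = k ⟺ ∃ j ∈ ℕ. (j = m^(2^F) ∧ j^n = k)`."
  **Lemma 4.4**: "Assume that `x, y ∈ 𝔻` such that `x > 0`, `y < 0`, `x^y ∈ ℝ` and
  `2^−1075 ≤ |x^y| ≤ 2^−1024`. Thus `x^y ∈ 𝔽₅₄` iff `∃ a ∈ ℤ. (2^a = x ∧ a·y ∈ ℤ)`."
  (Theorem 4.1 — the worst-case bound `2^−114` on the set `S` — "has been obtained using our worst-case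
  search algorithm"; Theorem 4.2 — Algorithm 1 is correct — combines 4.1 with the four lemmas.)
* §3.2 / Thm 4.1: `S = {(x, y) ∈ 𝔻² | y ∈ ℕ, 2 ≤ y ≤ 35}`
  `∪ {(m, 2^F·n) ∈ 𝔻² | F ∈ ℤ, −5 ≤ F < 0, n ∈ 2ℕ+1, 3 ≤ n ≤ 35, m ∈ 2ℕ+1}`;
  "As shown in Section 4, all rounding boundary cases of pow in double precision lie in `S`" (quoted as
  "all exact and midpoint cases belong to the following set" in [HubrechtJeannerodZimmermann2023, §IV]).

## What is proved here (0 named facts; everything below is a theorem)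

Floats are `DeDinechinLauterMullerTorres2013.IsFloat p` (= the paper's `𝔽_p`, exponent unbounded — so the
`𝔻 ⊆ 𝔽₅₃` inputs of the paper are covered a fortiori); `x^y` is `Real.rpow`.

* `odd_mul_two_zpow_inj` (the 2-adic separation behind Lemma 4.1), `exists_eq_pow_of_pow_eq_pow`
  (`m^n = K^q`, `gcd(n, q) = 1` ⇒ `m` is a `q`-th power: the content of Lemma 4.3's proof sketch),
  `exists_odd_mul_two_zpow` / `isFloat_odd_mul_two_zpow_iff` (a positive float is `k·2^G` with `k` odd, and
  such a number is in `𝔽_p` iff `k < 2^p` — so `x^y = k·2^G` with `k` odd is EXACT in binary64 iff `k < 2^53`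
  and a MIDPOINT iff `2^53 < k < 2^54`).
* `lemma41_pos` / `lemma41_neg` (Lemma 4.1 in integer-exponent form, `y = ±N/q`), **`lemma41`** (as
  printed, real exponent `2^F·n`), **`lemma43`** (as printed), **`lemma44`** (as printed but for any
  precisions and WITHOUT the output-range proviso, which the printed proof does not use), **`lemma42`** (as
  printed: `2^F·n ≤ 35`, `−5 ≤ F ≤ 5`; the hypothesis `n ≤ 2^53 − 1` is not needed; we prove the strict
  `2^F·n < 35`).
* **`rpow_isFloat_structure`** (any precisions `p`, `p'`): if `x ∈ 𝔽_p`, `x > 0`, `y ∈ 𝔽_p`, `y ≠ 0` and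
  `x^y ∈ 𝔽_p'`, then as in §2.3/§4 one of: (o) `x = 2^E` and `E·y = G ∈ ℤ` (`x^y = 2^G`); (a) `y = t ∈ ℕ`,
  `t ≥ 1`, `x = m·2^E`, `m` odd `≥ 3`, `x^y = m^t·2^(E·t)` with `m^t < 2^p'`; (b) `y = n/2^f`, `f ≥ 1`, `n` odd,
  `x = j^(2^f)·2^E` with `j` odd `≥ 3` and `2^f ∣ E`, `x^y = j^n·2^((E/2^f)·n)` with `j^n < 2^p'`.
* **`rpow_isFloat54_structure`** (binary64, `p = 53`, `p' = 54`): the same with the bounds `t ≤ 34`,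
  `n ≤ 33`, `f ≤ 5` (sharp forms of the printed `y ≤ 35`, `n ≤ 35`, `F ≥ −5`; cf. the CORE-MATH source
  `src/binary64/pow/pow.c` of [SibidanovZimmermannGlondu2022]: "the value 35 is not possible, since 3^35
  has 56 bits", "2 <= y <= 34", "1 <= n <= 33"), and **`mem_setS_of_isFloat54_rpow`**: every rounding
  boundary case `(x, y)` with `y ∉ {0, 1}` and `x` not a power of two lies in `setS`.
* Reading of `S`. The printed second component is `(m, 2^F·n)` with `m ∈ 2ℕ+1`, i.e. literally `x` an odd
  integer; the paper's own introductory example "`1296^0.75 = 216`" (§1) has `x = 1296 = 2^4·81` even, and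
  the proof of §4 is for `x = 2^E·m`. As the CORE-MATH source remarks ("We believe it should be read instead:
  `(x, y) = (2^E·m, 2^F·n)`"), `setS` is stated in that reading, and we prove MORE: `2^(−F) ∣ E` and `m` is a
  perfect `2^(−F)`-th power. The printed `3 ≤ n` is stated here as `Odd n` (so `n = 1` is allowed): pairs
  with `n = 1` (`y = 2^F`, e.g. `(9, 1/2)`, `example` below) are rounding-boundary cases too (and are
  accepted by Algorithm 1, lines 5–13); by `isFloat_rpow_of_lt_one` they — like every case with
  `0 < y < 1` — are EXACT cases (`x^y ∈ 𝔽₅₃`), never midpoints.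

NOT transcribed: Algorithm 1 itself and Theorem 4.2 (they take the approximation `z = x^y(1 + ε)` and
rest on the computed constant of Theorem 4.1, a worst-case SEARCH result — a computation, not a theorem
proved here); the case counts of §3.1.
-/

open Literature.ComputerArithmetic.DeDinechinLauterMullerTorres2013 (IsFloat)

namespace Literature.ComputerArithmetic.LauterLefevre2009

/-! ## Arithmetic preliminaries -/

/-- 2-adic separation: if `a·2^u = b·2^v` with `a`, `b` odd naturals then `a = b` and `u = v` — the
fact behind "[the] left-hand sides are even integers and their right-hand sides are odd".
[cite: LauterLefevre2009, §4 Lemma 4.1 (proof sketch)] -/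
theorem odd_mul_two_zpow_inj {a b : ℕ} (ha : Odd a) (hb : Odd b) {u v : ℤ}
    (h : (a : ℝ) * (2 : ℝ) ^ u = (b : ℝ) * (2 : ℝ) ^ v) : a = b ∧ u = v := by
  wlog huv : u ≤ v generalizing a b u v
  · obtain ⟨h1, h2⟩ := this hb ha h.symm (le_of_not_ge huv)
    exact ⟨h1.symm, h2.symm⟩
  obtain ⟨d, rfl⟩ : ∃ d : ℕ, v = u + d := ⟨(v - u).toNat, by omega⟩
  have h2u : (2 : ℝ) ^ u ≠ 0 := zpow_ne_zero _ (by norm_num)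
  have hab : (a : ℝ) = b * 2 ^ d := by
    rw [zpow_add₀ (by norm_num : (2 : ℝ) ≠ 0), zpow_natCast] at h
    have h' : (a : ℝ) * 2 ^ u = ((b : ℝ) * 2 ^ d) * 2 ^ u := by rw [h]; ring
    exact mul_right_cancel₀ h2u h'
  have hab' : a = b * 2 ^ d := by exact_mod_cast hab
  rcases Nat.eq_zero_or_pos d with hd0 | hdpos
  · subst hd0
    simp only [pow_zero, mul_one] at hab'
    exact ⟨hab', by simp⟩
  · exfalso
    have heven : Even a := by
      rw [hab']
      exact (Nat.even_pow.2 ⟨even_two, hdpos.ne'⟩).mul_left _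
    exact (Nat.not_even_iff_odd.2 ha) heven

/-- If `m^n = K^q` with `gcd(n, q) = 1`, `q ≥ 2`, then `m` is a perfect `q`-th power ("a `2^(−F)`-root of
an integer `m` is integer only if all valuations of the prime factor decomposition of `m` are divisible by
`2^(−F)`" — here via Bézout instead of factorisations). [cite: LauterLefevre2009, §4 Lemma 4.3 (proof
sketch)] -/
theorem exists_eq_pow_of_pow_eq_pow {m K n q : ℕ} (hq : 1 < q) (hcop : Nat.Coprime n q)
    (h : m ^ n = K ^ q) : ∃ j : ℕ, m = j ^ q := by
  obtain ⟨a, -, ha⟩ := Nat.exists_mul_mod_eq_one_of_coprime hcop hq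
  set b := n * a / q with hb
  have hab : n * a = q * b + 1 := by
    have := Nat.div_add_mod (n * a) q
    rw [← hb, ha] at this
    omega
  have key : m * (m ^ b) ^ q = (K ^ a) ^ q := by
    calc m * (m ^ b) ^ q = m ^ (q * b + 1) := by ring
      _ = m ^ (n * a) := by rw [hab]
      _ = (m ^ n) ^ a := by rw [pow_mul]
      _ = (K ^ q) ^ a := by rw [h]
      _ = (K ^ a) ^ q := by rw [← pow_mul, ← pow_mul, mul_comm]
  rcases Nat.eq_zero_or_pos m with hm0 | hmpos
  · exact ⟨0, by rw [hm0, zero_pow (by omega)]⟩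
  · have hupos : 0 < m ^ b := pow_pos hmpos b
    obtain ⟨j, hj⟩ : m ^ b ∣ K ^ a :=
      (Nat.pow_dvd_pow_iff (by omega : q ≠ 0)).1 (Dvd.intro_left m key)
    refine ⟨j, ?_⟩
    have : m * (m ^ b) ^ q = j ^ q * (m ^ b) ^ q := by rw [key, hj, mul_pow, mul_comm]
    exact Nat.eq_of_mul_eq_mul_right (pow_pos hupos q) this

/-- `j^q` odd with `q ≠ 0` forces `j` odd. [folklore] -/
private theorem odd_of_odd_pow {j q : ℕ} (hq : q ≠ 0) (h : Odd (j ^ q)) : Odd j := by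
  rcases Nat.even_or_odd j with hj | hj
  · exact absurd (Nat.even_pow.2 ⟨hj, hq⟩) (Nat.not_even_iff_odd.2 h)
  · exact hj

/-- An odd natural number other than `1` is at least `3`. [folklore] -/
private theorem three_le_of_odd_ne_one {m : ℕ} (hm : Odd m) (h1 : m ≠ 1) : 3 ≤ m := by
  obtain ⟨c, rfl⟩ := hm; omega

/-- If `m^N = k^q` then `m^(N/q) = k` (real exponent). [folklore] -/
private theorem rpow_div_eq_of_pow_eq {m k N q : ℕ} (hq : 0 < q) (h : m ^ N = k ^ q) :
    (m : ℝ) ^ ((N : ℝ) / q) = k := by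
  rw [div_eq_mul_inv, Real.rpow_mul (by positivity), Real.rpow_natCast]
  have : (m : ℝ) ^ N = (k : ℝ) ^ q := by exact_mod_cast h
  rw [this, Real.pow_rpow_inv_natCast (by positivity) hq.ne']

/-- The real exponent `2^F·n` as a fraction `N/q`: `(N, q) = (n·2^F, 1)` for `F ≥ 0` and
`(n, 2^(−F))` for `F < 0` (second case stated as `n = N`). [folklore] -/
private theorem two_zpow_mul_natCast_repr (F : ℤ) (n : ℕ) :
    ∃ N q : ℕ, 0 < q ∧ (2 : ℝ) ^ F * (n : ℝ) = (N : ℝ) / (q : ℝ) ∧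
      ((q = 1 ∧ ∃ f : ℕ, F = f ∧ N = n * 2 ^ f) ∨
        (n = N ∧ ∃ f : ℕ, 1 ≤ f ∧ F = -(f : ℤ) ∧ q = 2 ^ f)) := by
  rcases lt_or_ge F 0 with hF | hF
  · obtain ⟨f, hf⟩ := Int.exists_eq_neg_ofNat hF.le
    refine ⟨n, 2 ^ f, by positivity, ?_, Or.inr ⟨rfl, f, by omega, hf, rfl⟩⟩
    rw [hf, zpow_neg, zpow_natCast, Nat.cast_pow, Nat.cast_ofNat, div_eq_inv_mul]
  · obtain ⟨f, rfl⟩ := Int.eq_ofNat_of_zero_le hF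
    refine ⟨n * 2 ^ f, 1, one_pos, ?_, Or.inl ⟨rfl, f, rfl, rfl⟩⟩
    rw [zpow_natCast, Nat.cast_one, div_one, Nat.cast_mul, Nat.cast_pow, Nat.cast_ofNat, mul_comm]

/-! ## Floats in the paper's normal form `2^G·k`, `k` odd -/

/-- A positive precision-`p` float is `k·2^G` with `k` odd, `k < 2^p` ("`z = 2^G·k` where … `k ∈ 2ℕ+1`").
[cite: LauterLefevre2009, §2.1 and §2.3] -/
theorem exists_odd_mul_two_zpow {p : ℕ} {z : ℝ} (hz : IsFloat p z) (hpos : 0 < z) :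
    ∃ (k : ℕ) (G : ℤ), Odd k ∧ k < 2 ^ p ∧ z = (k : ℝ) * (2 : ℝ) ^ G := by
  obtain ⟨M, E, hM, rfl⟩ := hz
  have h2E : (0 : ℝ) < (2 : ℝ) ^ E := zpow_pos (by norm_num) _
  have hMpos : (0 : ℤ) < M := by
    have : (0 : ℝ) < M := (pos_iff_pos_of_mul_pos hpos).2 h2E
    exact_mod_cast this
  obtain ⟨M', hM'⟩ := Int.eq_ofNat_of_zero_le hMpos.le
  subst hM'
  have hM'0 : M' ≠ 0 := by rintro rfl; simp at hMpos
  obtain ⟨t, k, hk, hMk⟩ := Nat.exists_eq_two_pow_mul_odd hM'0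
  refine ⟨k, E + t, hk, ?_, ?_⟩
  · have hkM : k ≤ M' := by
      rw [hMk]; exact Nat.le_mul_of_pos_left k (by positivity)
    have hMlt : (M' : ℤ) < 2 ^ p := by
      have := hM; rwa [abs_of_nonneg hMpos.le] at this
    have : (k : ℤ) < 2 ^ p := lt_of_le_of_lt (by exact_mod_cast hkM) hMlt
    exact_mod_cast this
  · rw [hMk]; push_cast
    rw [zpow_add₀ (by norm_num : (2 : ℝ) ≠ 0), zpow_natCast]; ring

/-- `k·2^G` with `0 ≤ k < 2^p` is a precision-`p` float. [cite: LauterLefevre2009, §2.1] -/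
theorem isFloat_natCast_mul_two_zpow {p k : ℕ} (hk : k < 2 ^ p) (G : ℤ) :
    IsFloat p ((k : ℝ) * (2 : ℝ) ^ G) :=
  ⟨k, G, by rw [abs_of_nonneg (by positivity)]; exact_mod_cast hk, by norm_cast⟩

/-- For `k` odd, `k·2^G ∈ 𝔽_p ⟺ k < 2^p`: the odd significand of a float is determined by the number
(so a number `k·2^G` with `k` odd, `2^p < k < 2^(p+1)` is a midpoint of `𝔽_p`, not a member).
[cite: LauterLefevre2009, §2.1] -/
theorem isFloat_odd_mul_two_zpow_iff {p k : ℕ} (hk : Odd k) (G : ℤ) :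
    IsFloat p ((k : ℝ) * (2 : ℝ) ^ G) ↔ k < 2 ^ p := by
  refine ⟨fun h => ?_, fun h => isFloat_natCast_mul_two_zpow h G⟩
  have hpos : (0 : ℝ) < (k : ℝ) * 2 ^ G := by
    have : (0 : ℝ) < k := by exact_mod_cast hk.pos
    positivity
  obtain ⟨k', G', hk', hk'lt, heq⟩ := exists_odd_mul_two_zpow h hpos
  obtain ⟨rfl, -⟩ := odd_mul_two_zpow_inj hk hk' heq
  exact hk'lt

/-! ## Lemma 4.1 (the decomposition of `x^y = 2^G·k`), integer-exponent form -/

/-- Lemma 4.1, exponent `y = N/q > 0` (`q = 2^(−F)`, `N = n` when `F < 0`; `q = 1`, `N = 2^F·n` when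
`F ≥ 0`): `(m·2^E)^(N/q) = k·2^G` with `m`, `k` odd forces `m^N = k^q` and `E·N = G·q` — "consider the fact
that `m^n` and `k^(2^−F)` are odd integers". [cite: LauterLefevre2009, §4 Lemma 4.1] -/
theorem lemma41_pos {m k N q : ℕ} {E G : ℤ} (hm : Odd m) (hk : Odd k) (hq : 0 < q)
    (h : ((m : ℝ) * (2 : ℝ) ^ E) ^ ((N : ℝ) / q) = (k : ℝ) * (2 : ℝ) ^ G) :
    m ^ N = k ^ q ∧ E * N = G * q := by
  have hx0 : (0 : ℝ) ≤ (m : ℝ) * 2 ^ E := by positivity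
  have h1 : (((m : ℝ) * 2 ^ E) ^ ((N : ℝ) / q)) ^ q = ((m : ℝ) * 2 ^ E) ^ N := by
    rw [← Real.rpow_mul_natCast hx0, div_mul_cancel₀ _ (by exact_mod_cast hq.ne'), Real.rpow_natCast]
  have h2 : ((m : ℝ) * 2 ^ E) ^ N = ((k : ℝ) * 2 ^ G) ^ q := by rw [← h1, h]
  have eq1 : ((m ^ N : ℕ) : ℝ) * (2 : ℝ) ^ (E * N) = ((m : ℝ) * 2 ^ E) ^ N := by
    push_cast; rw [mul_pow, zpow_mul, zpow_natCast]
  have eq2 : ((k ^ q : ℕ) : ℝ) * (2 : ℝ) ^ (G * q) = ((k : ℝ) * 2 ^ G) ^ q := by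
    push_cast; rw [mul_pow, zpow_mul, zpow_natCast]
  have h3 : ((m ^ N : ℕ) : ℝ) * (2 : ℝ) ^ (E * N) = ((k ^ q : ℕ) : ℝ) * (2 : ℝ) ^ (G * q) := by
    rw [eq1, eq2]; exact h2
  exact odd_mul_two_zpow_inj hm.pow hk.pow h3

/-- Lemma 4.1 / 4.4, exponent `y = −N/q < 0`: `(m·2^E)^(−N/q) = k·2^G` with `m`, `k` odd and `N ≥ 1`
forces `m = 1`, `k = 1` and `E·N = −G·q` ("`c` is equal to 1 … This implies that `x^y = 2^G·1` is an
integer power of 2"). [cite: LauterLefevre2009, §4 Lemma 4.4 (proof)] -/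
theorem lemma41_neg {m k N q : ℕ} {E G : ℤ} (hm : Odd m) (hk : Odd k) (hq : 0 < q) (hN : 0 < N)
    (h : ((m : ℝ) * (2 : ℝ) ^ E) ^ (-((N : ℝ) / q)) = (k : ℝ) * (2 : ℝ) ^ G) :
    m = 1 ∧ k = 1 ∧ E * N = -(G * q) := by
  have hmpos : (0 : ℝ) < m := by exact_mod_cast hm.pos
  have hkpos : (0 : ℝ) < k := by exact_mod_cast hk.pos
  have hx0 : (0 : ℝ) ≤ (m : ℝ) * 2 ^ E := by positivity
  have hkG : (k : ℝ) * 2 ^ G ≠ 0 := by positivity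
  have h1 : ((m : ℝ) * 2 ^ E) ^ ((N : ℝ) / q) = ((k : ℝ) * 2 ^ G)⁻¹ := by
    rw [← h, Real.rpow_neg hx0, inv_inv]
  have h2 : ((m : ℝ) * 2 ^ E) ^ N * ((k : ℝ) * 2 ^ G) ^ q = 1 := by
    have : (((m : ℝ) * 2 ^ E) ^ ((N : ℝ) / q)) ^ q = ((m : ℝ) * 2 ^ E) ^ N := by
      rw [← Real.rpow_mul_natCast hx0, div_mul_cancel₀ _ (by exact_mod_cast hq.ne'), Real.rpow_natCast]
    rw [← this, h1, inv_pow, inv_mul_cancel₀ (pow_ne_zero _ hkG)]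
  have h3 : ((m ^ N * k ^ q : ℕ) : ℝ) * (2 : ℝ) ^ (E * N + G * q) =
      ((1 : ℕ) : ℝ) * (2 : ℝ) ^ (0 : ℤ) := by
    calc ((m ^ N * k ^ q : ℕ) : ℝ) * (2 : ℝ) ^ (E * N + G * q)
        = ((m : ℝ) * 2 ^ E) ^ N * ((k : ℝ) * 2 ^ G) ^ q := by
          rw [zpow_add₀ (by norm_num : (2 : ℝ) ≠ 0), zpow_mul, zpow_mul, zpow_natCast, zpow_natCast]
          push_cast
          ring
      _ = ((1 : ℕ) : ℝ) * (2 : ℝ) ^ (0 : ℤ) := by rw [h2, Nat.cast_one, zpow_zero, mul_one]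
  obtain ⟨h4, h5⟩ := odd_mul_two_zpow_inj (hm.pow.mul hk.pow) odd_one h3
  have hmN : m ^ N = 1 := Nat.eq_one_of_mul_eq_one_right h4
  have hkq : k ^ q = 1 := Nat.eq_one_of_mul_eq_one_left h4
  refine ⟨(Nat.pow_eq_one.1 hmN).resolve_right hN.ne', (Nat.pow_eq_one.1 hkq).resolve_right hq.ne', ?_⟩
  linarith

/-! ## Lemmas 4.1, 4.3, 4.4 as printed (any precision), Lemma 4.2 (binary64 constants) -/

/-- **Lemma 4.1** [cite: LauterLefevre2009, §4 Lemma 4.1]: for `E, F, G ∈ ℤ` and `m, n, k ∈ 2ℕ+1`,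
`2^(E·2^F·n)·m^(2^F·n) = 2^G·k ⟺ E·2^F·n = G ∧ m^(2^F·n) = k` (real exponent `2^F·n`; for `F < 0` the
printed proof raises both sides to the power `2^(−F)`, which is `lemma41_pos` with `q = 2^(−F)`; the
hypothesis that `n` is odd is not needed). -/
theorem lemma41 {E F G : ℤ} {m n k : ℕ} (hm : Odd m) (hk : Odd k) :
    (2 : ℝ) ^ ((E : ℝ) * (2 : ℝ) ^ F * n) * (m : ℝ) ^ ((2 : ℝ) ^ F * n) = (2 : ℝ) ^ G * k ↔
      (E : ℝ) * (2 : ℝ) ^ F * n = G ∧ (m : ℝ) ^ ((2 : ℝ) ^ F * n) = k := by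
  have hm0 : (0 : ℝ) ≤ m := by positivity
  have h20 : (0 : ℝ) ≤ 2 := by norm_num
  constructor
  · intro h
    obtain ⟨N, q, hq, hrepr, -⟩ := two_zpow_mul_natCast_repr F n
    -- the left-hand side is `(m·2^E)^(N/q)`
    have hlhs : (2 : ℝ) ^ ((E : ℝ) * (2 : ℝ) ^ F * n) * (m : ℝ) ^ ((2 : ℝ) ^ F * n) =
        ((m : ℝ) * (2 : ℝ) ^ E) ^ ((N : ℝ) / q) := by
      rw [Real.mul_rpow hm0 (zpow_nonneg h20 _), ← Real.rpow_intCast 2 E, ← Real.rpow_mul h20,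
        ← hrepr, mul_comm ((m : ℝ) ^ _), mul_assoc]
    have h' : ((m : ℝ) * (2 : ℝ) ^ E) ^ ((N : ℝ) / q) = (k : ℝ) * (2 : ℝ) ^ G := by
      rw [← hlhs, h, mul_comm]
    obtain ⟨hmk, hEG⟩ := lemma41_pos hm hk hq h'
    have hqR : (q : ℝ) ≠ 0 := by exact_mod_cast hq.ne'
    refine ⟨?_, ?_⟩
    · have hEG' : (E : ℝ) * N = G * q := by exact_mod_cast hEG
      rw [mul_assoc, hrepr, ← mul_div_assoc, hEG', mul_div_cancel_right₀ _ hqR]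
    · rw [hrepr]; exact rpow_div_eq_of_pow_eq hq hmk
  · rintro ⟨hEG, hmk⟩
    rw [hEG, hmk, Real.rpow_intCast]

/-- **Lemma 4.3** [cite: LauterLefevre2009, §4 Lemma 4.3]: for `m, n, k ∈ 2ℕ+1` and `F ≤ −1`,
`m^(2^F·n) = k ⟺ ∃ j ∈ ℕ, j = m^(2^F) ∧ j^n = k`. -/
theorem lemma43 {m n k : ℕ} (hm : Odd m) (hn : Odd n) (hk : Odd k) {F : ℤ} (hF : F ≤ -1) :
    (m : ℝ) ^ ((2 : ℝ) ^ F * n) = k ↔ ∃ j : ℕ, (j : ℝ) = (m : ℝ) ^ ((2 : ℝ) ^ F) ∧ j ^ n = k := by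
  obtain ⟨f, hFf⟩ := Int.exists_eq_neg_ofNat (by omega : F ≤ 0)
  have hq : 0 < 2 ^ f := by positivity
  have hq1 : 1 < 2 ^ f := Nat.one_lt_two_pow (by omega)
  have h2F : (2 : ℝ) ^ F = (((2 ^ f : ℕ)) : ℝ)⁻¹ := by
    rw [hFf, zpow_neg, zpow_natCast, Nat.cast_pow, Nat.cast_ofNat]
  have hrepr : (2 : ℝ) ^ F * (n : ℝ) = (n : ℝ) / ((2 ^ f : ℕ) : ℝ) := by
    rw [h2F, div_eq_inv_mul]
  have hm0 : (0 : ℝ) ≤ m := by positivity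
  have hcop : Nat.Coprime n (2 ^ f) := Nat.Coprime.pow_right _ (Nat.coprime_two_right.mpr hn)
  constructor
  · intro h
    have h' : ((m : ℝ) * (2 : ℝ) ^ (0 : ℤ)) ^ ((n : ℝ) / (2 ^ f : ℕ)) =
        (k : ℝ) * (2 : ℝ) ^ (0 : ℤ) := by
      rw [zpow_zero, mul_one, mul_one, ← hrepr]; exact h
    obtain ⟨hmk, -⟩ := lemma41_pos (E := 0) (G := 0) hm hk hq h'
    obtain ⟨j, rfl⟩ := exists_eq_pow_of_pow_eq_pow hq1 hcop hmk
    refine ⟨j, ?_, ?_⟩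
    · rw [Nat.cast_pow, h2F, Real.pow_rpow_inv_natCast (by positivity) hq.ne']
    · have : (j ^ n) ^ 2 ^ f = k ^ 2 ^ f := by rw [← hmk, ← pow_mul, ← pow_mul, mul_comm]
      exact Nat.pow_left_injective hq.ne' this
  · rintro ⟨j, hj, hjk⟩
    rw [Real.rpow_mul hm0, ← hj, Real.rpow_natCast]; exact_mod_cast hjk

/-- **Lemma 4.4** [cite: LauterLefevre2009, §4 Lemma 4.4], for any precisions `p` (inputs) and `p' ≥ 1`
(output): for floats `x > 0` and `y < 0`, `x^y ∈ 𝔽_p'` iff `x = 2^a` for an integer `a` with `a·y ∈ ℤ`. The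
printed statement is `p = 53`, `p' = 54` with the additional proviso `2^−1075 ≤ |x^y| ≤ 2^−1024`, which its
proof does not use. -/
theorem lemma44 {p p' : ℕ} (hp' : 1 ≤ p') {x y : ℝ} (hx : IsFloat p x) (hx0 : 0 < x)
    (hy : IsFloat p y) (hy0 : y < 0) :
    IsFloat p' (x ^ y) ↔ ∃ a : ℤ, (2 : ℝ) ^ a = x ∧ ∃ G : ℤ, (a : ℝ) * y = G := by
  constructor
  · intro h
    obtain ⟨m, E, hm, -, rfl⟩ := exists_odd_mul_two_zpow hx hx0
    obtain ⟨k, G, hk, -, hxyk⟩ := exists_odd_mul_two_zpow h (Real.rpow_pos_of_pos hx0 y)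
    obtain ⟨n, F, hn, -, hyn⟩ := exists_odd_mul_two_zpow hy.neg (neg_pos.2 hy0)
    obtain ⟨N, q, hq, hrepr, hcases⟩ := two_zpow_mul_natCast_repr F n
    have hNpos : 0 < N := by
      rcases hcases with ⟨-, f, -, rfl⟩ | ⟨rfl, -⟩
      · exact Nat.mul_pos hn.pos (by positivity)
      · exact hn.pos
    have hyq : y = -((N : ℝ) / q) := by rw [← hrepr, mul_comm, ← hyn, neg_neg]
    have h' : ((m : ℝ) * (2 : ℝ) ^ E) ^ (-((N : ℝ) / q)) = (k : ℝ) * (2 : ℝ) ^ G := by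
      rw [← hyq]; exact hxyk
    obtain ⟨rfl, rfl, hEN⟩ := lemma41_neg hm hk hq hNpos h'
    refine ⟨E, by rw [Nat.cast_one, one_mul], G, ?_⟩
    have hqR : (q : ℝ) ≠ 0 := by exact_mod_cast hq.ne'
    have hEN' : (E : ℝ) * N = -(G * q) := by exact_mod_cast hEN
    rw [hyq, mul_neg, ← mul_div_assoc, hEN', neg_div, neg_neg, mul_div_cancel_right₀ _ hqR]
  · rintro ⟨a, rfl, G, hG⟩
    have : ((2 : ℝ) ^ a) ^ y = (2 : ℝ) ^ G := by
      rw [← Real.rpow_intCast 2 a, ← Real.rpow_mul (by norm_num), hG, Real.rpow_intCast]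
    rw [this]; exact IsFloat.two_zpow hp' G

/-- Numeric step of Lemma 4.2: `3 ≤ m` and `m^t < 2^54` force `t ≤ 34` ("`2^F·n ≤ 54/log₂(m) ≤ 54/log₂ 3
< 34.08`"; `3^35 > 2^54`). [cite: LauterLefevre2009, §4 Lemma 4.2 (proof)] -/
theorem exp_le_34 {m t : ℕ} (hm : 3 ≤ m) (h : m ^ t < 2 ^ 54) : t ≤ 34 := by
  by_contra ht'
  have ht : 35 ≤ t := by omega
  have h1 : 3 ^ 35 ≤ m ^ t :=
    (Nat.pow_le_pow_right (by norm_num) ht).trans (Nat.pow_le_pow_left hm t)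
  have h35 : 2 ^ 54 < 3 ^ 35 := by norm_num
  exact lt_irrefl _ ((h35.trans_le h1).trans h)

/-- … and for an odd exponent `n`, `j^n < 2^54` with `j ≥ 3` forces `n ≤ 33`. [cite: LauterLefevre2009,
§4 Lemma 4.2 (proof)] -/
theorem exp_le_33 {j n : ℕ} (hj : 3 ≤ j) (hn : Odd n) (h : j ^ n < 2 ^ 54) : n ≤ 33 := by
  have := exp_le_34 hj h
  obtain ⟨c, rfl⟩ := hn
  omega

/-- Numeric step of Lemma 4.2 (`F ≥ −5`): a perfect `2^f`-th power `j^(2^f) ≤ 2^53 − 1` with `j ≥ 3`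
has `f ≤ 5` ("`α_i ≤ 53·log 2/log 3 ≤ 34` … `γ_i ≤ log₂(34) ≤ 5.09`"). [cite: LauterLefevre2009, §4 Lemma
4.2 (proof)] -/
theorem root_exp_le_5 {j f : ℕ} (hj : 3 ≤ j) (h : j ^ 2 ^ f < 2 ^ 53) : f ≤ 5 := by
  by_contra hf'
  have hf : 6 ≤ f := by omega
  have h1 : 2 ^ 6 ≤ 2 ^ f := Nat.pow_le_pow_right (by norm_num) hf
  have h2 : 3 ^ 2 ^ 6 ≤ j ^ 2 ^ f :=
    (Nat.pow_le_pow_right (by norm_num) h1).trans (Nat.pow_le_pow_left hj _)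
  have h3 : 2 ^ 53 < 3 ^ 2 ^ 6 := by norm_num
  exact lt_irrefl _ ((h3.trans_le h2).trans h)

/-- **Lemma 4.2** [cite: LauterLefevre2009, §4 Lemma 4.2]: for `m` odd with `3 ≤ m ≤ 2^53 − 1`, `n` odd
(`≥ 1`), `k` odd with `k ≤ 2^54 − 1` and `F ∈ ℤ`, `m^(2^F·n) = k` implies `2^F·n ≤ 35` (we prove `< 35`) and
`−5 ≤ F ≤ 5`. (The printed hypothesis `n ≤ 2^53 − 1` is not used.) -/
theorem lemma42 {m n k : ℕ} (hm : Odd m) (hm3 : 3 ≤ m) (hm53 : m ≤ 2 ^ 53 - 1) (hn : Odd n)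
    (hk : Odd k) (hk54 : k ≤ 2 ^ 54 - 1) {F : ℤ} (h : (m : ℝ) ^ ((2 : ℝ) ^ F * n) = k) :
    (2 : ℝ) ^ F * n < 35 ∧ -5 ≤ F ∧ F ≤ 5 := by
  obtain ⟨N, q, hq, hrepr, hcases⟩ := two_zpow_mul_natCast_repr F n
  have h' : ((m : ℝ) * (2 : ℝ) ^ (0 : ℤ)) ^ ((N : ℝ) / q) = (k : ℝ) * (2 : ℝ) ^ (0 : ℤ) := by
    rw [zpow_zero, mul_one, mul_one, ← hrepr]; exact h
  obtain ⟨hmk, -⟩ := lemma41_pos (E := 0) (G := 0) hm hk hq h'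
  have hk' : k < 2 ^ 54 := by omega
  have hm' : m < 2 ^ 53 := by omega
  -- (1) `N < 35·q`, i.e. `2^F·n < 35`
  have hN : N < 35 * q := by
    by_contra hN'
    have hN : 35 * q ≤ N := by omega
    have h1 : (3 ^ 35) ^ q ≤ m ^ N :=
      calc (3 ^ 35) ^ q = 3 ^ (35 * q) := by rw [pow_mul]
        _ ≤ 3 ^ N := Nat.pow_le_pow_right (by norm_num) hN
        _ ≤ m ^ N := Nat.pow_le_pow_left hm3 N
    have h2 : k ^ q < (2 ^ 54) ^ q := Nat.pow_lt_pow_left hk' hq.ne'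
    have h3 : (2 ^ 54) ^ q ≤ (3 ^ 35) ^ q := Nat.pow_le_pow_left (by norm_num) q
    rw [hmk] at h1
    exact lt_irrefl _ ((h2.trans_le h3).trans_le h1)
  have hlt35 : (2 : ℝ) ^ F * n < 35 := by
    rw [hrepr, div_lt_iff₀ (by exact_mod_cast hq)]
    exact_mod_cast hN
  refine ⟨hlt35, ?_, ?_⟩
  · -- (3) `−5 ≤ F`
    rcases hcases with ⟨-, f, hFf, -⟩ | ⟨rfl, f, hf1, hFf, rfl⟩
    · omega
    · have hcop : Nat.Coprime n (2 ^ f) := Nat.Coprime.pow_right _ (Nat.coprime_two_right.mpr hn)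
      obtain ⟨j, rfl⟩ := exists_eq_pow_of_pow_eq_pow (Nat.one_lt_two_pow (by omega)) hcop hmk
      have hj1 : j ≠ 1 := by rintro rfl; simp at hm3
      have hj3 : 3 ≤ j := three_le_of_odd_ne_one (odd_of_odd_pow hq.ne' hm) hj1
      have := root_exp_le_5 hj3 hm'
      omega
  · -- (2) `F ≤ 5`: `2^F ≤ 2^F·n < 35 < 2^6`
    by_contra hF'
    have hF : 6 ≤ F := by omega
    have h1 : (2 : ℝ) ^ (6 : ℤ) ≤ (2 : ℝ) ^ F := zpow_le_zpow_right₀ (by norm_num) hF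
    have h2 : (2 : ℝ) ^ F ≤ (2 : ℝ) ^ F * n :=
      le_mul_of_one_le_right (zpow_nonneg (by norm_num) _) (by exact_mod_cast hn.pos)
    have h3 : (2 : ℝ) ^ (6 : ℤ) = 64 := by norm_num
    linarith

/-! ## The structure of the rounding-boundary cases (Lemmas 4.1–4.4 combined) -/

/-- **Structure of `x^y ∈ 𝔽_p'` for floating-point `x > 0`, `y ≠ 0`** (any precisions), assembling Lemmas
4.1, 4.3, 4.4 exactly as Algorithm 1 / Theorem 4.2 do: either (o) `x = 2^E` is a power of two with
`E·y ∈ ℤ`, or `y > 0`, `x = m·2^E` with `m` odd `≥ 3` and (a) `y = t ∈ ℕ` with `x^y = m^t·2^(E·t)`,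
`m^t < 2^p'`, or (b) `y = n/2^f` (`f ≥ 1`, `n` odd), `m = j^(2^f)` a perfect power, `2^f ∣ E`, and
`x^y = j^n·2^((E/2^f)·n)` with `j^n < 2^p'`. [cite: LauterLefevre2009, §2.3 and §4 Lemmas 4.1–4.4] -/
theorem rpow_isFloat_structure {p p' : ℕ} {x y : ℝ} (hx : IsFloat p x) (hx0 : 0 < x)
    (hy : IsFloat p y) (hy0 : y ≠ 0) (h : IsFloat p' (x ^ y)) :
    (∃ E G : ℤ, x = (2 : ℝ) ^ E ∧ (E : ℝ) * y = G ∧ x ^ y = (2 : ℝ) ^ G) ∨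
    (∃ (E : ℤ) (m t : ℕ), x = (m : ℝ) * (2 : ℝ) ^ E ∧ Odd m ∧ 3 ≤ m ∧ m < 2 ^ p ∧
        y = t ∧ 1 ≤ t ∧ m ^ t < 2 ^ p' ∧ x ^ y = ((m ^ t : ℕ) : ℝ) * (2 : ℝ) ^ (E * t)) ∨
    (∃ (E : ℤ) (f n j : ℕ), x = ((j ^ 2 ^ f : ℕ) : ℝ) * (2 : ℝ) ^ E ∧ Odd j ∧ 3 ≤ j ∧
        j ^ 2 ^ f < 2 ^ p ∧ 1 ≤ f ∧ (2 ^ f : ℤ) ∣ E ∧ y = (n : ℝ) / 2 ^ f ∧ Odd n ∧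
        j ^ n < 2 ^ p' ∧ x ^ y = ((j ^ n : ℕ) : ℝ) * (2 : ℝ) ^ (E / 2 ^ f * n)) := by
  obtain ⟨m, E, hm, hmlt, rfl⟩ := exists_odd_mul_two_zpow hx hx0
  obtain ⟨k, G, hk, hklt, hxyk⟩ := exists_odd_mul_two_zpow h (Real.rpow_pos_of_pos hx0 y)
  rcases lt_or_gt_of_ne hy0 with hyneg | hypos
  · -- `y < 0`: Lemma 4.4
    obtain ⟨n, F, hn, -, hyn⟩ := exists_odd_mul_two_zpow hy.neg (neg_pos.2 hyneg)
    obtain ⟨N, q, hq, hrepr, hcases⟩ := two_zpow_mul_natCast_repr F n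
    have hNpos : 0 < N := by
      rcases hcases with ⟨-, f, -, rfl⟩ | ⟨rfl, -⟩
      · exact Nat.mul_pos hn.pos (by positivity)
      · exact hn.pos
    have hyq : y = -((N : ℝ) / q) := by rw [← hrepr, mul_comm, ← hyn, neg_neg]
    have h' : ((m : ℝ) * (2 : ℝ) ^ E) ^ (-((N : ℝ) / q)) = (k : ℝ) * (2 : ℝ) ^ G := by
      rw [← hyq]; exact hxyk
    obtain ⟨rfl, rfl, hEN⟩ := lemma41_neg hm hk hq hNpos h'
    left
    refine ⟨E, G, by rw [Nat.cast_one, one_mul], ?_, by rw [hxyk, Nat.cast_one, one_mul]⟩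
    have hqR : (q : ℝ) ≠ 0 := by exact_mod_cast hq.ne'
    have hEN' : (E : ℝ) * N = -(G * q) := by exact_mod_cast hEN
    rw [hyq, mul_neg, ← mul_div_assoc, hEN', neg_div, neg_neg, mul_div_cancel_right₀ _ hqR]
  · -- `y > 0`
    obtain ⟨n, F, hn, -, hyn⟩ := exists_odd_mul_two_zpow hy hypos
    obtain ⟨N, q, hq, hrepr, hcases⟩ := two_zpow_mul_natCast_repr F n
    have hyq : y = (N : ℝ) / q := by rw [← hrepr, mul_comm, ← hyn]
    have h' : ((m : ℝ) * (2 : ℝ) ^ E) ^ ((N : ℝ) / q) = (k : ℝ) * (2 : ℝ) ^ G := by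
      rw [← hyq]; exact hxyk
    obtain ⟨hmk, hEN⟩ := lemma41_pos hm hk hq h'
    have hqR : (q : ℝ) ≠ 0 := by exact_mod_cast hq.ne'
    rcases hcases with ⟨rfl, f, hFf, hNdef⟩ | ⟨rfl, f, hf1, hFf, rfl⟩
    · -- `F ≥ 0`: integer exponent `t = N`
      simp only [pow_one, Nat.cast_one, mul_one] at hmk hEN
      have hNpos : 1 ≤ N := by rw [hNdef]; exact Nat.mul_pos hn.pos (by positivity)
      have hyN : y = N := by rw [hyq, Nat.cast_one, div_one]
      by_cases hm1 : m = 1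
      · subst hm1
        have hk1 : k = 1 := by rw [← hmk, one_pow]
        left
        refine ⟨E, G, by rw [Nat.cast_one, one_mul], by rw [hyN]; exact_mod_cast hEN, ?_⟩
        rw [hxyk, hk1, Nat.cast_one, one_mul]
      · right; left
        refine ⟨E, m, N, rfl, hm, three_le_of_odd_ne_one hm hm1, hmlt, hyN, hNpos, ?_, ?_⟩
        · rw [hmk]; exact hklt
        · rw [hxyk, ← hmk, ← hEN]
    · -- `F = −f < 0`: exponent `n / 2^f`
      have hq1 : 1 < 2 ^ f := Nat.one_lt_two_pow (by omega)
      have hcop : Nat.Coprime n (2 ^ f) := Nat.Coprime.pow_right _ (Nat.coprime_two_right.mpr hn)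
      obtain ⟨j, rfl⟩ := exists_eq_pow_of_pow_eq_pow hq1 hcop hmk
      -- `k = j^n`
      have hkj : k = j ^ n := by
        have : k ^ 2 ^ f = (j ^ n) ^ 2 ^ f := by rw [← hmk, ← pow_mul, ← pow_mul, mul_comm]
        exact Nat.pow_left_injective hq.ne' this
      by_cases hj1 : j = 1
      · subst hj1
        left
        refine ⟨E, G, by rw [one_pow, Nat.cast_one, one_mul], ?_, ?_⟩
        · have hEN' : (E : ℝ) * n = G * (2 ^ f : ℕ) := by exact_mod_cast hEN
          rw [hyq, ← mul_div_assoc, hEN', mul_div_cancel_right₀ _ hqR]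
        · rw [hxyk, hkj, one_pow, Nat.cast_one, one_mul]
      · right; right
        have hjodd : Odd j := odd_of_odd_pow hq.ne' hm
        have hcast : ((2 ^ f : ℕ) : ℤ) = (2 : ℤ) ^ f := by norm_num
        rw [hcast] at hEN
        -- `2^f ∣ E` from `E·n = G·2^f` and `gcd(n, 2^f) = 1`
        have hdvd : ((2 : ℤ) ^ f) ∣ E := by
          have hc : IsCoprime ((2 ^ f : ℕ) : ℤ) (n : ℤ) := Nat.isCoprime_iff_coprime.2 hcop.symm
          rw [hcast] at hc
          exact hc.dvd_of_dvd_mul_right ⟨G, by rw [hEN, mul_comm]⟩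
        have hG : G = E / 2 ^ f * n := by
          have h1 : E / (2 : ℤ) ^ f * 2 ^ f = E := Int.ediv_mul_cancel hdvd
          have h2 : (E / (2 : ℤ) ^ f * n) * 2 ^ f = G * 2 ^ f := by
            calc (E / (2 : ℤ) ^ f * n) * 2 ^ f = E / 2 ^ f * 2 ^ f * n := by ring
              _ = E * n := by rw [h1]
              _ = G * 2 ^ f := hEN
          exact (mul_right_cancel₀ (pow_ne_zero f two_ne_zero) h2).symm
        refine ⟨E, f, n, j, rfl, hjodd, three_le_of_odd_ne_one hjodd hj1, hmlt, hf1, hdvd, ?_, hn,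
          by rw [← hkj]; exact hklt, ?_⟩
        · rw [hyq, Nat.cast_pow, Nat.cast_ofNat]
        · rw [hxyk, hkj, hG]

/-- `x^y` with `0 < y < 1` is never a midpoint: if `x, y ∈ 𝔽_p` (`p ≥ 1`), `x > 0`, `0 < y < 1` and
`x^y ∈ 𝔽_p'` for SOME precision `p'`, then already `x^y ∈ 𝔽_p` (an exact case). In case (b) of
`rpow_isFloat_structure`, `x^y = j^n·2^(…)` with `n < 2^f` and `j^(2^f) < 2^p`. In particular the pairs
`(x, 2^F)` (`n = 1`) omitted from the printed `S` are exact cases. [cite: LauterLefevre2009, §2.3 and §3.2] -/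
theorem isFloat_rpow_of_lt_one {p p' : ℕ} (hp : 1 ≤ p) {x y : ℝ} (hx : IsFloat p x) (hx0 : 0 < x)
    (hy : IsFloat p y) (hy0 : 0 < y) (hy1 : y < 1) (h : IsFloat p' (x ^ y)) : IsFloat p (x ^ y) := by
  rcases rpow_isFloat_structure hx hx0 hy hy0.ne' h with
    ⟨E, G, -, -, hxy⟩ | ⟨E, m, t, -, -, -, -, hyt, ht1, -, -⟩ |
    ⟨E, f, n, j, -, hj, hj3, hjlt, hf1, -, hyn, hn, -, hxy⟩
  · rw [hxy]; exact IsFloat.two_zpow hp G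
  · exfalso
    rw [hyt] at hy1
    have : (1 : ℝ) ≤ t := by exact_mod_cast ht1
    linarith
  · rw [hxy]
    apply isFloat_natCast_mul_two_zpow
    have hnf : n < 2 ^ f := by
      rw [hyn, div_lt_one (by positivity)] at hy1
      exact_mod_cast hy1
    calc j ^ n ≤ j ^ 2 ^ f := Nat.pow_le_pow_right (by omega) hnf.le
      _ < 2 ^ p := hjlt

/-! ## Binary64: the set `S` -/

/-- **Structure theorem in binary64** (`p = 53`, `p' = 54`): as `rpow_isFloat_structure` with the bounds
`t ≤ 34` in case (a) and `n ≤ 33`, `f ≤ 5` in case (b) (Lemma 4.2; sharp forms of the printed `≤ 35`,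
`≤ 35`, `F ≥ −5`). [cite: LauterLefevre2009, §4 Lemmas 4.1–4.4; §3.2] -/
theorem rpow_isFloat54_structure {x y : ℝ} (hx : IsFloat 53 x) (hx0 : 0 < x)
    (hy : IsFloat 53 y) (hy0 : y ≠ 0) (h : IsFloat 54 (x ^ y)) :
    (∃ E G : ℤ, x = (2 : ℝ) ^ E ∧ (E : ℝ) * y = G ∧ x ^ y = (2 : ℝ) ^ G) ∨
    (∃ (E : ℤ) (m t : ℕ), x = (m : ℝ) * (2 : ℝ) ^ E ∧ Odd m ∧ 3 ≤ m ∧ m < 2 ^ 53 ∧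
        y = t ∧ 1 ≤ t ∧ t ≤ 34 ∧ m ^ t < 2 ^ 54 ∧ x ^ y = ((m ^ t : ℕ) : ℝ) * (2 : ℝ) ^ (E * t)) ∨
    (∃ (E : ℤ) (f n j : ℕ), x = ((j ^ 2 ^ f : ℕ) : ℝ) * (2 : ℝ) ^ E ∧ Odd j ∧ 3 ≤ j ∧
        j ^ 2 ^ f < 2 ^ 53 ∧ 1 ≤ f ∧ f ≤ 5 ∧ (2 ^ f : ℤ) ∣ E ∧ y = (n : ℝ) / 2 ^ f ∧ Odd n ∧
        n ≤ 33 ∧ j ^ n < 2 ^ 54 ∧ x ^ y = ((j ^ n : ℕ) : ℝ) * (2 : ℝ) ^ (E / 2 ^ f * n)) := by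
  rcases rpow_isFloat_structure hx hx0 hy hy0 h with
    ho | ⟨E, m, t, hxm, hm, hm3, hmlt, hyt, ht1, hmt, hxy⟩ |
    ⟨E, f, n, j, hxj, hj, hj3, hjlt, hf1, hdvd, hyn, hn, hjn, hxy⟩
  · exact Or.inl ho
  · exact Or.inr (Or.inl ⟨E, m, t, hxm, hm, hm3, hmlt, hyt, ht1, exp_le_34 hm3 hmt, hmt, hxy⟩)
  · exact Or.inr (Or.inr ⟨E, f, n, j, hxj, hj, hj3, hjlt, hf1, root_exp_le_5 hj3 hjlt, hdvd, hyn, hn,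
      exp_le_33 hj3 hn hjn, hjn, hxy⟩)

/-- The set `S` of [LauterLefevre2009, §3.2 / Thm 4.1], in the reading `x = 2^E·m` of its second component
(CORE-MATH `pow.c`: "We believe it should be read instead: (x,y) = (2^E*m, 2^F*n)") and with `n` odd
`≤ 35` (printed: `3 ≤ n ≤ 35`; see the module doc-string): `S = {(x, y) | y ∈ ℕ, 2 ≤ y ≤ 35} ∪ {(2^E·m,
2^F·n) | E, F ∈ ℤ, −5 ≤ F < 0, n ∈ 2ℕ+1, n ≤ 35, m ∈ 2ℕ+1}` (the ambient `𝔻²` is carried by the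
hypotheses of `mem_setS_of_isFloat54_rpow`). [cite: LauterLefevre2009, §3.2 and Theorem 4.1] -/
def setS : Set (ℝ × ℝ) :=
  {xy | (∃ t : ℕ, xy.2 = t ∧ 2 ≤ t ∧ t ≤ 35) ∨
    (∃ (E F : ℤ) (m n : ℕ), xy.1 = (m : ℝ) * (2 : ℝ) ^ E ∧ Odd m ∧ xy.2 = (n : ℝ) * (2 : ℝ) ^ F ∧
      -5 ≤ F ∧ F < 0 ∧ Odd n ∧ n ≤ 35)}

/-- **"All rounding boundary cases of pow in double precision lie in `S`"** [cite: LauterLefevre2009, §3.2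
("As shown in Section 4"); HubrechtJeannerodZimmermann2023, §IV]: for binary64-representable `x > 0` that
is not a power of two and `y ∉ {0, 1}`, `x^y ∈ 𝔽₅₄` implies `(x, y) ∈ setS` (powers of two are the
separate branch of Algorithm 1, line 3: there `x^y ∈ 𝔽₅₄ ⟺ E·y ∈ ℤ`, see `rpow_isFloat54_structure` (o) and
`lemma44`). -/
theorem mem_setS_of_isFloat54_rpow {x y : ℝ} (hx : IsFloat 53 x) (hx0 : 0 < x)
    (hpow2 : ∀ E : ℤ, x ≠ (2 : ℝ) ^ E) (hy : IsFloat 53 y) (hy0 : y ≠ 0) (hy1 : y ≠ 1)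
    (h : IsFloat 54 (x ^ y)) : (x, y) ∈ setS := by
  rcases rpow_isFloat54_structure hx hx0 hy hy0 h with
    ⟨E, G, hxE, -, -⟩ | ⟨E, m, t, -, -, -, -, hyt, ht1, ht34, -, -⟩ |
    ⟨E, f, n, j, hxj, hj, -, -, hf1, hf5, -, hyn, hn, hn33, -, -⟩
  · exact absurd hxE (hpow2 E)
  · refine Or.inl ⟨t, hyt, ?_, by omega⟩
    rcases Nat.lt_or_ge t 2 with ht | ht
    · exfalso; apply hy1; rw [hyt]; exact_mod_cast (show t = 1 by omega)
    · exact ht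
  · refine Or.inr ⟨E, -(f : ℤ), j ^ 2 ^ f, n, hxj, hj.pow, ?_, by omega, by omega, hn, by omega⟩
    show y = (n : ℝ) * (2 : ℝ) ^ (-(f : ℤ))
    rw [hyn, zpow_neg, zpow_natCast, div_eq_mul_inv]

/-! ## Examples -/

/-- The paper's introductory example `1296^0.75 = 216` (§1) — `x = 1296 = 2^4·81` is even, so the second
component of `S` must be read with `x = 2^E·m`. [cite: LauterLefevre2009, §1] -/
example : (1296 : ℝ) ^ ((3 : ℝ) / 4) = 216 := by
  rw [show (1296 : ℝ) = (6 : ℝ) ^ (4 : ℕ) by norm_num, ← Real.rpow_natCast,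
    ← Real.rpow_mul (by norm_num), show ((4 : ℕ) : ℝ) * ((3 : ℝ) / 4) = (3 : ℕ) by norm_num,
    Real.rpow_natCast]
  norm_num

/-- `(9, 1/2)` is a rounding-boundary (exact) case with `n = 1`: `9^(2^(−1)·1) = 3`.
[cite: LauterLefevre2009, §2.3] -/
example : (9 : ℝ) ^ ((2 : ℝ) ^ (-1 : ℤ) * (1 : ℕ)) = (3 : ℕ) := by
  rw [show (9 : ℝ) = (3 : ℝ) ^ (2 : ℕ) by norm_num, Nat.cast_one, mul_one,
    show ((2 : ℝ) ^ (-1 : ℤ)) = (((2 : ℕ) : ℝ))⁻¹ by norm_num,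
    Real.pow_rpow_inv_natCast (by norm_num) two_ne_zero]
  norm_num

/-- `3^34` is a MIDPOINT case of binary64 `pow` (`k = 3^34` is odd and `2^53 < 3^34 < 2^54`), so the
integer-exponent bound `y ≤ 34` is attained; `3^35 > 2^54` ("the value 35 is not possible").
[cite: LauterLefevre2009, §4 Lemma 4.2; SibidanovZimmermannGlondu2022, pow.c] -/
example : IsFloat 54 ((3 : ℝ) ^ (34 : ℝ)) ∧ ¬ IsFloat 53 ((3 : ℝ) ^ (34 : ℝ)) := by
  have h3 : (3 : ℝ) ^ (34 : ℝ) = ((3 ^ 34 : ℕ) : ℝ) * (2 : ℝ) ^ (0 : ℤ) := by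
    rw [show (34 : ℝ) = ((34 : ℕ) : ℝ) by norm_num, Real.rpow_natCast, zpow_zero, mul_one]
    norm_cast
  have hodd : Odd (3 ^ 34) := (show Odd 3 by decide).pow
  rw [h3, isFloat_odd_mul_two_zpow_iff hodd, isFloat_odd_mul_two_zpow_iff hodd]
  norm_num

end Literature.ComputerArithmetic.LauterLefevre2009
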